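import Summits.CriticalPhenomena.PercolationContinuityZ3.Theorems.PercNearOneGluingNoHeavyLowerTailOneLayerTwoFingerTools
import HarnessLib

/-!
# `NoHeavyLowerTail` (stmt-CriticalPhenomena-4575), |A| = 5 rung — one-layer observer-relays: CORE THEOREM (part 2 of 3)

Support file (prover prim-cplus-engine gen 11; `--supports stmt-CriticalPhenomena-4575`).  See part 1
(`…OneLayerTwoFingerTools`) for the setting and the proof sketch; this part proves `oneLayer_core`:
for a one-layer observer `o` with targets `a, b, c, d`, hairs ordered `h_a ≤ h_b ≤ h_c, h_d` and
`(1−h_a)(1−h_b)(1−h_c)(1−h_d) ≤ 1/4`:  `μ(o ↔ a) ≤ μ(some two of a,b,c,d are both joined to o)`.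
[cite: KozmaNitzan2024, Lemma 5 (p. 13) and Thm. 4 (pp. 12–14)]
-/

noncomputable section

namespace Summit.CriticalPhenomena.PercolationContinuityZ3.Theorems

open MeasureTheory Set Literature.Probability.Percolation Literature.Probability.Percolation.KNPreFKG
open Literature.Probability.LatticeModels (prodBernoulli)

namespace OneLayerTwoFinger

variable {V : Type*} [Fintype V] [DecidableEq V]

/-! ### The theorem (core version: `b` carries the smallest of the three other hairs) -/

/-- Core of `oneLayer_openConn_weakestHair_le_twoFingers`, with the other targets ordered so that
`h_b ≤ h_c, h_d`. [cite: KozmaNitzan2024, Lemma 5 (p. 13) and Thm. 4 (pp. 12–14)] -/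
theorem oneLayer_core (w : Sym2 V → unitInterval) (o a b c d : V)
    (hao : a ≠ o) (hbo : b ≠ o) (hco : c ≠ o) (hdo : d ≠ o)
    (hab : a ≠ b) (hac : a ≠ c) (had : a ≠ d) (hbc : b ≠ c) (hbd : b ≠ d) (hcd : c ≠ d)
    (hiso : ∀ u, u ≠ o → u ≠ a → u ≠ b → u ≠ c → u ≠ d → w s(o, u) = 0)
    (hmb : (w s(o, a) : ℝ) ≤ w s(o, b)) (hbc' : (w s(o, b) : ℝ) ≤ w s(o, c)) (hbd' : (w s(o, b) : ℝ) ≤ w s(o, d))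
    (hHC : (1 - (w s(o, a) : ℝ)) * (1 - w s(o, b)) * (1 - w s(o, c)) * (1 - w s(o, d)) ≤ 1 / 4) :
    (prodBernoulli w).real (openConn o a) ≤
      (prodBernoulli w).real {ω : BondConfig V |
        (ω ∈ openConn o a ∧ ω ∈ openConn o b) ∨ (ω ∈ openConn o a ∧ ω ∈ openConn o c) ∨
        (ω ∈ openConn o a ∧ ω ∈ openConn o d) ∨ (ω ∈ openConn o b ∧ ω ∈ openConn o c) ∨
        (ω ∈ openConn o b ∧ ω ∈ openConn o d) ∨ (ω ∈ openConn o c ∧ ω ∈ openConn o d)} := by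
  classical
  set μ := prodBernoulli w with hμ
  haveI : IsProbabilityMeasure μ := by rw [hμ]; infer_instance
  -- hairs
  set ea : Sym2 V := s(o, a) with hea
  set eb : Sym2 V := s(o, b) with heb
  set ec : Sym2 V := s(o, c) with hec
  set ed : Sym2 V := s(o, d) with hed
  have hab' : eb ≠ ea := by rw [heb, hea]; exact fun h => hab (Sym2.congr_right.1 h).symm
  have hac' : ec ≠ ea := by rw [hec, hea]; exact fun h => hac (Sym2.congr_right.1 h).symm
  have had' : ed ≠ ea := by rw [hed, hea]; exact fun h => had (Sym2.congr_right.1 h).symm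
  have hbc'' : ec ≠ eb := by rw [hec, heb]; exact fun h => hbc (Sym2.congr_right.1 h).symm
  have hbd'' : ed ≠ eb := by rw [hed, heb]; exact fun h => hbd (Sym2.congr_right.1 h).symm
  have hcd'' : ed ≠ ec := by rw [hed, hec]; exact fun h => hcd (Sym2.congr_right.1 h).symm
  -- events
  set Xa : Set (BondConfig V) := openConn o a with hXa
  set Xb : Set (BondConfig V) := openConn o b with hXb
  set Xc : Set (BondConfig V) := openConn o c with hXc
  set Xd : Set (BondConfig V) := openConn o d with hXd
  set N2 : Set (BondConfig V) := {ω | (ω ∈ Xa ∧ ω ∈ Xb) ∨ (ω ∈ Xa ∧ ω ∈ Xc) ∨ (ω ∈ Xa ∧ ω ∈ Xd) ∨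
      (ω ∈ Xb ∧ ω ∈ Xc) ∨ (ω ∈ Xb ∧ ω ∈ Xd) ∨ (ω ∈ Xc ∧ ω ∈ Xd)} with hN2
  set Alone : Set (BondConfig V) := Xa ∩ Xbᶜ ∩ Xcᶜ ∩ Xdᶜ with hAlone
  set Iso : Set (BondConfig V) := {ω | ω ∉ openConnIn ({o}ᶜ : Set V) a b} ∩
      {ω | ω ∉ openConnIn ({o}ᶜ : Set V) a c} ∩ {ω | ω ∉ openConnIn ({o}ᶜ : Set V) a d} with hIso
  set G0 : Set (BondConfig V) := {ω | ∀ u, u ≠ o → u ≠ a → u ≠ b → u ≠ c → u ≠ d → s(o, u) ∉ ω} with hG0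
  set H1 : Set (BondConfig V) := (({ω | eb ∉ ω} ∩ {ω | ec ∉ ω}) ∩ {ω | ed ∉ ω}) ∩ {ω | ea ∈ ω} with hH1
  set T1 : Set (BondConfig V) := ({ω | ec ∉ ω} ∩ {ω | ed ∉ ω})ᶜ ∩ {ω | eb ∈ ω} with hT1
  set T2 : Set (BondConfig V) := ({ω | ec ∈ ω} ∩ {ω | ed ∈ ω}) ∩ {ω | eb ∉ ω} with hT2
  set T : Set (BondConfig V) := (T1 ∪ T2) ∩ {ω | ea ∉ ω} with hT
  -- (F1) the null set
  have hG0c : μ.real G0ᶜ = 0 := by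
    set U : Finset V := Finset.univ.filter fun u => u ≠ o ∧ u ≠ a ∧ u ≠ b ∧ u ≠ c ∧ u ≠ d with hU
    have hsub : G0ᶜ ⊆ ⋃ u ∈ U, {ω : BondConfig V | s(o, u) ∈ ω} := by
      intro ω hω
      simp only [hG0, mem_compl_iff, mem_setOf_eq, not_forall, not_not, exists_prop] at hω
      obtain ⟨u, huo, hua, hub, huc, hud, hu⟩ := hω
      simp only [mem_iUnion, mem_setOf_eq, exists_prop]
      exact ⟨u, by simp [hU, huo, hua, hub, huc, hud], hu⟩
    refine le_antisymm ?_ measureReal_nonneg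
    calc μ.real G0ᶜ ≤ μ.real (⋃ u ∈ U, {ω : BondConfig V | s(o, u) ∈ ω}) :=
          measureReal_mono hsub (measure_ne_top μ _)
      _ ≤ ∑ u ∈ U, μ.real {ω : BondConfig V | s(o, u) ∈ ω} := measureReal_biUnion_finset_le U _
      _ = 0 := by
        refine Finset.sum_eq_zero fun u hu => ?_
        simp only [hU, Finset.mem_filter, Finset.mem_univ, true_and] at hu
        rw [hμ, Literature.Probability.LatticeModels.prodBernoulli_real_setOf_mem,
          hiso u hu.1 hu.2.1 hu.2.2.1 hu.2.2.2.1 hu.2.2.2.2]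
        rfl
  have hnull : ∀ E : Set (BondConfig V), μ.real E ≤ μ.real (E ∩ G0) := by
    intro E
    have h1 : E ⊆ (E ∩ G0) ∪ G0ᶜ := by
      intro ω hω
      by_cases hG : ω ∈ G0
      · exact Or.inl ⟨hω, hG⟩
      · exact Or.inr hG
    calc μ.real E ≤ μ.real ((E ∩ G0) ∪ G0ᶜ) := measureReal_mono h1
      _ ≤ μ.real (E ∩ G0) + μ.real G0ᶜ := measureReal_union_le _ _
      _ = μ.real (E ∩ G0) := by rw [hG0c, add_zero]
  -- (F2) `Alone ∩ G0 ⊆ H1 ∩ Iso`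
  have hF2 : Alone ∩ G0 ⊆ H1 ∩ Iso := by
    rintro ω ⟨⟨⟨⟨hXa', hXb'⟩, hXc'⟩, hXd'⟩, hG⟩
    have hG' : ∀ u, u ≠ o → u ≠ a → u ≠ b → u ≠ c → u ≠ d → s(o, u) ∉ ω := hG
    have hb : eb ∉ ω := fun h => hXb' (openConn_of_mem hbo h)
    have hc : ec ∉ ω := fun h => hXc' (openConn_of_mem hco h)
    have hd : ed ∉ ω := fun h => hXd' (openConn_of_mem hdo h)
    obtain ⟨u, hu, huo, hou, hux⟩ := exists_hair_of_openConn hao hG' hXa'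
    have ha : ea ∈ ω := by
      rcases hu with rfl | rfl | rfl | rfl
      · exact hou
      · exact absurd hou hb
      · exact absurd hou hc
      · exact absurd hou hd
    refine ⟨⟨⟨⟨hb, hc⟩, hd⟩, ha⟩, ⟨⟨?_, ?_⟩, ?_⟩⟩
    · exact fun h => hXb' (SimpleGraph.Reachable.trans hXa' (reachable_of_openConnIn h))
    · exact fun h => hXc' (SimpleGraph.Reachable.trans hXa' (reachable_of_openConnIn h))
    · exact fun h => hXd' (SimpleGraph.Reachable.trans hXa' (reachable_of_openConnIn h))
  -- (F3) `T ∩ Iso ∩ G0 ⊆ N2 ∩ Xaᶜ`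
  have hF3 : (T ∩ Iso) ∩ G0 ⊆ N2 ∩ Xaᶜ := by
    rintro ω ⟨⟨⟨hT12, ha⟩, ⟨⟨hIb, hIc⟩, hId⟩⟩, hG⟩
    have hG' : ∀ u, u ≠ o → u ≠ a → u ≠ b → u ≠ c → u ≠ d → s(o, u) ∉ ω := hG
    have ha' : ea ∉ ω := ha
    constructor
    · rcases hT12 with ⟨hcd0, hb⟩ | ⟨⟨hc, hd⟩, -⟩
      · have hb' : ω ∈ Xb := openConn_of_mem hbo hb
        simp only [mem_compl_iff, mem_inter_iff, mem_setOf_eq, not_and_or, not_not] at hcd0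
        rcases hcd0 with hc | hd
        · exact Or.inr (Or.inr (Or.inr (Or.inl ⟨hb', openConn_of_mem hco hc⟩)))
        · exact Or.inr (Or.inr (Or.inr (Or.inr (Or.inl ⟨hb', openConn_of_mem hdo hd⟩))))
      · exact Or.inr (Or.inr (Or.inr (Or.inr (Or.inr ⟨openConn_of_mem hco hc, openConn_of_mem hdo hd⟩))))
    · intro hXa'
      obtain ⟨u, hu, huo, hou, hux⟩ := exists_hair_of_openConn hao hG' hXa'
      rcases hu with rfl | rfl | rfl | rfl
      · exact ha' hou
      · exact hIb (openConnIn_comm.1 hux)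
      · exact hIc (openConnIn_comm.1 hux)
      · exact hId (openConnIn_comm.1 hux)
  -- (F4) determinacy and independence
  set F : Finset (Sym2 V) := {ea, eb, ec, ed} with hF
  have hIsoDet : DeterminedBy Iso (↑F : Set (Sym2 V))ᶜ := by
    have hW : wireSet ({o}ᶜ : Set V) ⊆ (↑F : Set (Sym2 V))ᶜ := by
      intro e he heF
      have hoe : o ∈ e := by
        simp only [hF, Finset.coe_insert, Finset.coe_singleton, mem_insert_iff, mem_singleton_iff] at heF
        rcases heF with rfl | rfl | rfl | rfl <;> exact Sym2.mem_mk_left _ _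
      exact he.1 o hoe rfl
    have h1 := fun y => determinedBy_compl ((determinedBy_openConnIn ({o}ᶜ : Set V) a y).mono hW)
    exact ((h1 b).inter (h1 c)).inter (h1 d)
  have hF_sub : ∀ e : Sym2 V, e = ea ∨ e = eb ∨ e = ec ∨ e = ed → e ∈ (↑F : Set (Sym2 V)) := by
    intro e he
    simp only [hF, Finset.coe_insert, Finset.coe_singleton, mem_insert_iff, mem_singleton_iff]
    tauto
  have hH1Det : DeterminedBy H1 (↑F : Set (Sym2 V)) :=
    (((determinedBy_notMem_of_mem (hF_sub eb (by tauto))).inter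
      (determinedBy_notMem_of_mem (hF_sub ec (by tauto)))).inter
      (determinedBy_notMem_of_mem (hF_sub ed (by tauto)))).inter
      (determinedBy_mem_of_mem (hF_sub ea (by tauto)))
  have hTDet : DeterminedBy T (↑F : Set (Sym2 V)) := by
    have hb1 := determinedBy_mem_of_mem (hF_sub eb (by tauto))
    have hb0 := determinedBy_notMem_of_mem (hF_sub eb (by tauto))
    have hc1 := determinedBy_mem_of_mem (hF_sub ec (by tauto))
    have hc0 := determinedBy_notMem_of_mem (hF_sub ec (by tauto))
    have hd1 := determinedBy_mem_of_mem (hF_sub ed (by tauto))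
    have hd0 := determinedBy_notMem_of_mem (hF_sub ed (by tauto))
    have ha0 := determinedBy_notMem_of_mem (hF_sub ea (by tauto))
    exact (determinedBy_union ((determinedBy_compl (hc0.inter hd0)).inter hb1) ((hc1.inter hd1).inter hb0)).inter ha0
  have hind : ∀ E : Set (BondConfig V), DeterminedBy E (↑F : Set (Sym2 V)) →
      μ.real (E ∩ Iso) = μ.real E * μ.real Iso := fun E hE =>
    Literature.Probability.LatticeModels.prodBernoulli_real_inter_of_determinedBy w F hE hIsoDet
      MeasurableSet.of_discrete MeasurableSet.of_discrete
  -- (F5) the two hair probabilities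
  set xa : ℝ := ((w ea : unitInterval) : ℝ) with hxa
  set xb : ℝ := ((w eb : unitInterval) : ℝ) with hxb
  set xc : ℝ := ((w ec : unitInterval) : ℝ) with hxc
  set xd : ℝ := ((w ed : unitInterval) : ℝ) with hxd
  have hD1 : DeterminedBy (({ω : BondConfig V | eb ∉ ω} ∩ {ω | ec ∉ ω}) ∩ {ω | ed ∉ ω}) ({ea} : Set (Sym2 V))ᶜ :=
    ((determinedBy_notMem_compl hab').inter (determinedBy_notMem_compl hac')).inter (determinedBy_notMem_compl had')
  have hD2 : DeterminedBy ({ω : BondConfig V | eb ∉ ω} ∩ {ω | ec ∉ ω}) ({ed} : Set (Sym2 V))ᶜ :=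
    (determinedBy_notMem_compl hbd''.symm).inter (determinedBy_notMem_compl hcd''.symm)
  have hD3 : DeterminedBy {ω : BondConfig V | eb ∉ ω} ({ec} : Set (Sym2 V))ᶜ := determinedBy_notMem_compl hbc''.symm
  have hH1val : μ.real H1 = (1 - xb) * (1 - xc) * (1 - xd) * xa := by
    rw [hH1, real_inter_mem w ea hD1, real_inter_notMem w ed hD2, real_inter_notMem w ec hD3,
      Literature.Probability.LatticeModels.prodBernoulli_real_setOf_notMem]
  have hE1 : DeterminedBy ({ω : BondConfig V | ec ∉ ω} ∩ {ω | ed ∉ ω})ᶜ ({eb} : Set (Sym2 V))ᶜ :=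
    determinedBy_compl ((determinedBy_notMem_compl hbc'').inter (determinedBy_notMem_compl hbd''))
  have hcd0 : μ.real ({ω : BondConfig V | ec ∉ ω} ∩ {ω | ed ∉ ω}) = (1 - xc) * (1 - xd) := by
    rw [real_inter_notMem w ed (determinedBy_notMem_compl hcd''.symm),
      Literature.Probability.LatticeModels.prodBernoulli_real_setOf_notMem]
  have hcompl : μ.real ({ω : BondConfig V | ec ∉ ω} ∩ {ω | ed ∉ ω})ᶜ = 1 - (1 - xc) * (1 - xd) := by
    have := measureReal_add_measureReal_compl (μ := μ)
      (s := ({ω : BondConfig V | ec ∉ ω} ∩ {ω | ed ∉ ω})) MeasurableSet.of_discrete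
    rw [probReal_univ, hcd0] at this
    linarith
  have hT1val : μ.real T1 = (1 - (1 - xc) * (1 - xd)) * xb := by
    rw [hT1, real_inter_mem w eb hE1, hcompl]
  have hE2 : DeterminedBy ({ω : BondConfig V | ec ∈ ω} ∩ {ω | ed ∈ ω}) ({eb} : Set (Sym2 V))ᶜ :=
    (determinedBy_mem_compl hbc'').inter (determinedBy_mem_compl hbd'')
  have hE3 : DeterminedBy {ω : BondConfig V | ec ∈ ω} ({ed} : Set (Sym2 V))ᶜ := determinedBy_mem_compl hcd''.symm
  have hT2val : μ.real T2 = xc * xd * (1 - xb) := by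
    rw [hT2, real_inter_notMem w eb hE2, real_inter_mem w ed hE3,
      Literature.Probability.LatticeModels.prodBernoulli_real_setOf_mem]
  have hT12 : Disjoint T1 T2 := by
    rw [Set.disjoint_left]
    rintro ω ⟨-, hb⟩ ⟨-, hb'⟩
    exact hb' hb
  have hE4 : DeterminedBy (T1 ∪ T2) ({ea} : Set (Sym2 V))ᶜ :=
    determinedBy_union
      ((determinedBy_compl ((determinedBy_notMem_compl hac').inter (determinedBy_notMem_compl had'))).inter
        (determinedBy_mem_compl hab'))
      (((determinedBy_mem_compl hac').inter (determinedBy_mem_compl had')).inter (determinedBy_notMem_compl hab'))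
  have hTval : μ.real T = ((1 - (1 - xc) * (1 - xd)) * xb + xc * xd * (1 - xb)) * (1 - xa) := by
    rw [hT, real_inter_notMem w ea hE4, measureReal_union hT12 MeasurableSet.of_discrete, hT1val, hT2val]
  -- (F6) the real inequality
  have hx01 : ∀ e : Sym2 V, 0 ≤ (w e : ℝ) ∧ (w e : ℝ) ≤ 1 := fun e => ⟨(w e).2.1, (w e).2.2⟩
  have hreal : μ.real H1 ≤ μ.real T := by
    rw [hH1val, hTval]
    have key := oneLayer_hair_ineq (x := xa) (y := xb) (z := xc) (t := xd) (hx01 ea).1 (hx01 ec).2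
      (hx01 ed).2 hmb hbc' hbd' hHC
    nlinarith [key]
  -- assembly
  have hIso0 : 0 ≤ μ.real Iso := measureReal_nonneg
  have hstep : μ.real Alone ≤ μ.real (N2 ∩ Xaᶜ) := by
    calc μ.real Alone ≤ μ.real (Alone ∩ G0) := hnull Alone
      _ ≤ μ.real (H1 ∩ Iso) := measureReal_mono hF2
      _ = μ.real H1 * μ.real Iso := hind H1 hH1Det
      _ ≤ μ.real T * μ.real Iso := mul_le_mul_of_nonneg_right hreal hIso0
      _ = μ.real (T ∩ Iso) := (hind T hTDet).symm
      _ ≤ μ.real ((T ∩ Iso) ∩ G0) := hnull _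
      _ ≤ μ.real (N2 ∩ Xaᶜ) := measureReal_mono hF3
  have hcover : Xa ⊆ (N2 ∩ Xa) ∪ Alone := by
    intro ω hω
    by_cases hb : ω ∈ Xb
    · exact Or.inl ⟨Or.inl ⟨hω, hb⟩, hω⟩
    by_cases hc : ω ∈ Xc
    · exact Or.inl ⟨Or.inr (Or.inl ⟨hω, hc⟩), hω⟩
    by_cases hd : ω ∈ Xd
    · exact Or.inl ⟨Or.inr (Or.inr (Or.inl ⟨hω, hd⟩)), hω⟩
    · exact Or.inr ⟨⟨⟨hω, hb⟩, hc⟩, hd⟩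
  have hsplit : μ.real (N2 ∩ Xa) + μ.real (N2 \ Xa) = μ.real N2 :=
    measureReal_inter_add_sdiff (μ := μ) (s := N2) (t := Xa) MeasurableSet.of_discrete
  calc μ.real Xa ≤ μ.real ((N2 ∩ Xa) ∪ Alone) := measureReal_mono hcover
    _ ≤ μ.real (N2 ∩ Xa) + μ.real Alone := measureReal_union_le _ _
    _ ≤ μ.real (N2 ∩ Xa) + μ.real (N2 ∩ Xaᶜ) := by linarith [hstep]
    _ = μ.real N2 := by rw [← hsplit]; rfl


end OneLayerTwoFinger

end Summit.CriticalPhenomena.PercolationContinuityZ3.Theorems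

end
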